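import Mathlib
import Literature.AlgebraicGeometry.Resolution.CompletedChainDescentTools
import Literature.AlgebraicGeometry.Resolution.CompletedChainCurveStep
import Literature.AlgebraicGeometry.Resolution.CompletedChainPolygonLaws
import Literature.AlgebraicGeometry.Resolution.AdaptedCentrePresentation
import Literature.AlgebraicGeometry.Resolution.PreparedUpToSwap
import Literature.AlgebraicGeometry.Resolution.PolygonSymmetry
import HarnessLib

/-!
# The curve level of the descent down the completed chain (`τ = 1` endgame, OPTION R, brick R-5: S-step-cv)

Topic: `Literature/AlgebraicGeometry/Resolution`. V. Cossart, U. Jannsen, S. Saito, LNM 2270 (2020), proof of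
Thm. 13.7 (pp. 157–158), Lemma 12.4, Claim 13.8 [cite: CossartJannsenSaito2020, Thm. 13.7]; V. Cossart, O. Piltant,
J. Algebra 320 (2008), Lemma 4.5 (1) [cite: CossartPiltant2008, Lemma 4.5].

OURS (one CURVE level of the completed-chain descent `CompletedChainDescent`, CONTRACT v3′ frame): from a totally
prepared adapted label `x = (ŷ, ι p₁, ι p₂)` of `R̂` with exact algebraic slots in the fixed print orientation, the
flag `e` (`span {p_e} = span {u_n}`), a presentation `(y₁, u_n)` of the centre `P`, and the clauses of a curve level
(`P R′ = (u_{n+1})`, the weak transform, permissibility `I ⊆ P^μ`, the chart `hcurve` for every adapted presentation,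
the next centre `hPsucc_cv`), a label of the same kind at level `n + 1` with `2β′ + [e′] ≤ 2β + [e]`, equality forcing
a GOOD step. The centre is re-presented through the label: `exists_span_pair_eq_of_adapted` on the algebraic
approximation `(l, p_e, p_o)` (`exists_adapted_label_of_completion`) and `exists_adapted_coordinate_of_hasMonic`, packaged as
`AdaptedCentrePresentation.exists_adapted_presentation_of_centre`, give an adapted `(y″, p_e, p_o)` with `(y″, p_e) = P`; then `completedChain_curve_step` runs on the label (flag 1;
`completedChain_curveStep_laws`: `β′ = β`, GOOD) or on the swapped label (flag 2, `preparedUpTo_forall_comp_σ₁₂`;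
`completedChain_curveStepTwo_laws`: `β′ + L ≤ β`), flag′ = flag. F-71 / T1 NOT proved; no summit statement is proved;
resolution in dimension `≥ 4` / positive characteristic is NOT proved. AI-written; weaker than expert review.
-/

noncomputable section

open IsLocalRing MvPolynomial

namespace Literature.AlgebraicGeometry.Resolution

universe u

/-! ## Small tools -/

section Tools

variable {S : Type u} [CommRing S]

/-- `{a, b, c} = {a, c, b}` under `Ideal.span`. [cite: Matsumura1987, §1 (p. 2)] -/
theorem span_triple_swap23' (a b d : S) : Ideal.span ({a, b, d} : Set S) = Ideal.span {a, d, b} := by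
  rw [Set.pair_comm b d]

/-- `(y, u) S′ = (φ u)` when `φ y = φ u · y′`. [cite: CossartPiltant2008, Lemma 4.3 (5)] -/
theorem map_span_pair_eq_span_of_mul {S' : Type u} [CommRing S'] (φ : S →+* S') {y v : S} {y' : S'}
    (hy : φ y = φ v * y') : (Ideal.span ({y, v} : Set S)).map φ = Ideal.span {φ v} := by
  rw [Ideal.map_span, Set.image_insert_eq, Set.image_singleton]
  apply le_antisymm
  · rw [Ideal.span_le, Set.insert_subset_iff, Set.singleton_subset_iff]
    exact ⟨Ideal.mem_span_singleton'.mpr ⟨y', by rw [hy, mul_comm]⟩, Ideal.mem_span_singleton_self _⟩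
  · exact Ideal.span_mono (Set.subset_insert _ _)

end Tools

/-! ## The curve level -/

section CurveStep

variable {R R' : Type u} [CommRing R] [CommRing R'] [IsRegularLocalRing R] [IsRegularLocalRing R']
  (φ : R →+* R') [IsLocalHom φ] (hφm : (maximalIdeal R).map φ ≤ maximalIdeal R')
  (hdim : ringKrullDim R = 3) (hdim' : ringKrullDim R' = 3)

include hφm hdim hdim' in
/-- **S-step-cv (OURS). The curve level of the descent down the completed chain.** See the module docstring.
[cite: CossartJannsenSaito2020, Thm. 13.7 (proof), Lemma 12.4, Claim 13.8] [cite: CossartPiltant2008, Lemma 4.5 (1)] -/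
theorem completedChain_descent_curveStep
    {I : Ideal R} {I' : Ideal R'} {μ : ℕ} (hμ : 1 ≤ μ)
    (hIμ : I ≤ maximalIdeal R ^ μ) (hIne : ¬ I ≤ maximalIdeal R ^ (μ + 1))
    (hIμ' : I' ≤ maximalIdeal R' ^ μ) (hIne' : ¬ I' ≤ maximalIdeal R' ^ (μ + 1))
    (hτ : ∀ c : Fin 3 → R, Ideal.span {c 0, c 1, c 2} = maximalIdeal R → hironakaTauAt c I μ = 1)
    (hτ' : ∀ c' : Fin 3 → R', Ideal.span {c' 0, c' 1, c' 2} = maximalIdeal R' → hironakaTauAt c' I' μ = 1)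
    (uN : R) (uN' : R') (isPt' : Prop) (P : Ideal R) (P' : Ideal R')
    (hexc_cv : P.map φ = Ideal.span {uN'})
    (hI : I' = (I.map φ).colon {uN' ^ μ})
    (hIP : I ≤ P ^ μ)
    (hcurve : ∀ (y v w : R), Ideal.span {v} = Ideal.span {uN} → Ideal.span {y, v} = P →
      Ideal.span {y, v, w} = maximalIdeal R →
      (∀ G ∈ initialForms ![y, v, w] I μ, ∃ a : ResidueField R, G = C a * X 0 ^ μ) →
      Function.Surjective (ResidueField.map φ) ∧
      ∃ y' : R', φ y = φ v * y' ∧ Ideal.span {y', φ v, φ w} = maximalIdeal R')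
    (hPsucc_cv : ¬ isPt' → ∀ (y v w : R) (y' : R'), Ideal.span {v} = Ideal.span {uN} →
      Ideal.span {y, v} = P → Ideal.span {y, v, w} = maximalIdeal R →
      (∀ G ∈ initialForms ![y, v, w] I μ, ∃ a : ResidueField R, G = C a * X 0 ^ μ) →
      φ y = φ v * y' → uN' ∈ P' ∧ ∃ β ∈ maximalIdeal R, Ideal.span {y' + φ β, uN'} = P')
    [IsRegularLocalRing (AdicCompletion (maximalIdeal R) R)] [IsRegularLocalRing (AdicCompletion (maximalIdeal R') R')]
    (x : Fin 3 → AdicCompletion (maximalIdeal R) R) (p₁ p₂ : R) (e : Bool)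
    (hx1 : x 1 = algebraMap R (AdicCompletion (maximalIdeal R) R) p₁)
    (hx2 : x 2 = algebraMap R (AdicCompletion (maximalIdeal R) R) p₂)
    (hgenx : Ideal.span {x 0, x 1, x 2} = maximalIdeal (AdicCompletion (maximalIdeal R) R))
    (hprep : ∀ B, PreparedUpTo x (I.map (algebraMap R (AdicCompletion (maximalIdeal R) R))) μ B)
    (hne : (pts x (I.map (algebraMap R (AdicCompletion (maximalIdeal R) R))) μ).Nonempty)
    (hδ : μ.factorial < deltaS x (I.map (algebraMap R (AdicCompletion (maximalIdeal R) R))) μ)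
    (hflag : Ideal.span {if e then p₂ else p₁} = Ideal.span {uN})
    (hpres : ∃ y₁ ∈ maximalIdeal R, Ideal.span {y₁, uN} = P) :
    ∃ (x' : Fin 3 → AdicCompletion (maximalIdeal R') R') (p₁' p₂' : R') (e' : Bool),
      x' 1 = algebraMap R' (AdicCompletion (maximalIdeal R') R') p₁' ∧
      x' 2 = algebraMap R' (AdicCompletion (maximalIdeal R') R') p₂' ∧
      Ideal.span {x' 0, x' 1, x' 2} = maximalIdeal (AdicCompletion (maximalIdeal R') R') ∧
      (∀ B, PreparedUpTo x' (I'.map (algebraMap R' (AdicCompletion (maximalIdeal R') R'))) μ B) ∧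
      (pts x' (I'.map (algebraMap R' (AdicCompletion (maximalIdeal R') R'))) μ).Nonempty ∧
      μ.factorial < deltaS x' (I'.map (algebraMap R' (AdicCompletion (maximalIdeal R') R'))) μ ∧
      Ideal.span {if e' then p₂' else p₁'} = Ideal.span {uN'} ∧
      (¬ isPt' → ∃ y₁ ∈ maximalIdeal R', Ideal.span {y₁, uN'} = P') ∧
      2 * betaS x' (I'.map (algebraMap R' (AdicCompletion (maximalIdeal R') R'))) μ + (if e' then 1 else 0) ≤
        2 * betaS x (I.map (algebraMap R (AdicCompletion (maximalIdeal R) R))) μ + (if e then 1 else 0) ∧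
      (2 * betaS x' (I'.map (algebraMap R' (AdicCompletion (maximalIdeal R') R'))) μ + (if e' then 1 else 0) =
          2 * betaS x (I.map (algebraMap R (AdicCompletion (maximalIdeal R) R))) μ + (if e then 1 else 0) →
        Function.Surjective (ResidueField.map φ) ∧ Ideal.span {uN'} = Ideal.span {φ uN}) := by
  classical
  have hL := Nat.factorial_pos μ
  haveI : IsDomain R := isDomain_of_isRegularLocalRing R
  haveI : IsDomain R' := isDomain_of_isRegularLocalRing R'
  have hdimA : ringKrullDim (AdicCompletion (maximalIdeal R) R) = 3 := by rw [ringKrullDim_adicCompletion, hdim]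
  have hdimB : ringKrullDim (AdicCompletion (maximalIdeal R') R') = 3 := by rw [ringKrullDim_adicCompletion, hdim']
  -- (0) the algebraic label `(l, p₁, p₂)` under `x`, adapted; the centre `P = (y₁, u_n)`
  obtain ⟨l, -, hgenR, hadR⟩ := exists_adapted_label_of_completion hdim hIμ x p₁ p₂ hx1 hx2 hgenx hδ
  obtain ⟨y₁, hy₁m, hP⟩ := hpres
  -- the curve clause of `completedChain_curve_step` in the frame of a slot element `v ~ u_n`
  have hcurve₁ : ∀ v : R, Ideal.span {v} = Ideal.span {uN} → ∀ (y w : R), Ideal.span {y, v} = P →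
      Ideal.span {y, v, w} = maximalIdeal R →
      (∀ G ∈ initialForms ![y, v, w] I μ, ∃ a : ResidueField R, G = C a * X 0 ^ μ) →
      ∃ y' : R', φ y = φ v * y' ∧ Ideal.span {y', φ v, φ w} = maximalIdeal R' :=
    fun v hv y w h1 h2 h3 => (hcurve y v w hv h1 h2 h3).2
  -- the adapted presentation `(y″, pf)` of `P` through an adapted label `(l, pf, po)` (p-8b's `AdaptedCentrePresentation`)
  have hpresent : ∀ pf po : R, Ideal.span {pf} = Ideal.span {uN} → Ideal.span {l, pf, po} = maximalIdeal R →
      (∀ G ∈ initialForms ![l, pf, po] I μ, ∃ a : ResidueField R, G = C a * X 0 ^ μ) →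
      ∃ y'' : R, Ideal.span {y'', pf, po} = maximalIdeal R ∧ Ideal.span {y'', pf} = P ∧
        ∀ G ∈ initialForms ![y'', pf, po] I μ, ∃ a : ResidueField R, G = C a * X 0 ^ μ := by
    intro pf po hf hgen had
    have hPf : Ideal.span {y₁, pf} = P := by rw [span_pair_eq_of_span_singleton_eq y₁ hf]; exact hP
    exact exists_adapted_presentation_of_centre hdim hμ hIμ hIne hτ l pf po hgen had hIP ⟨y₁, hy₁m, hPf⟩
  -- the next centre's presentation from `hPsucc_cv`
  have hpres_of : ∀ (pf po : R) (y'' : R) (y' : R'), Ideal.span {pf} = Ideal.span {uN} → Ideal.span {y'', pf} = P →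
      Ideal.span {y'', pf, po} = maximalIdeal R →
      (∀ G ∈ initialForms ![y'', pf, po] I μ, ∃ a : ResidueField R, G = C a * X 0 ^ μ) →
      φ y'' = φ pf * y' → Ideal.span {y', φ pf, φ po} = maximalIdeal R' →
      (¬ isPt' → ∃ y₂ ∈ maximalIdeal R', Ideal.span {y₂, uN'} = P') := by
    intro pf po y'' y' hf hP'' hgen'' had'' hy' hgen' hnp
    obtain ⟨-, β, hβ, hsp⟩ := hPsucc_cv hnp y'' pf po y' hf hP'' hgen'' had'' hy'
    refine ⟨y' + φ β, Ideal.add_mem _ (hgen' ▸ Ideal.subset_span (by simp)) (hφm (Ideal.mem_map_of_mem φ hβ)), hsp⟩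
  cases e
  · ---------------------------------------------------------------- flag 1: the `(0,1)` curve `(ŷ, p₁)`
    have hf : Ideal.span {p₁} = Ideal.span {uN} := by simpa using hflag
    obtain ⟨y'', hgen'', hP'', had''⟩ := hpresent p₁ p₂ hf hgenR hadR
    obtain ⟨hsurj, y', hy', hgen'⟩ := hcurve y'' p₁ p₂ hf hP'' hgen'' had''
    have huN' : Ideal.span {uN'} = Ideal.span {φ p₁} := by
      rw [← hexc_cv, ← hP'', map_span_pair_eq_span_of_mul φ hy']
    have hI₁ : I' = (I.map φ).colon {φ p₁ ^ μ} := hI.trans (colon_singleton_pow_eq_of_span_singleton_eq _ huN' μ)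
    obtain ⟨x', hx'1, hgen'x, h₀, hx'2, hperm, hprep', hne', hδ', -, -⟩ :=
      completedChain_curve_step φ hφm hdim hdim' hsurj p₁ hIμ hIne hIμ' hIne' hI₁ hτ' P hIP (hcurve₁ p₁ hf) x hx1 hgenx
        hprep hne hδ y'' p₂ hP'' hgen'' had'' (by rw [hx2, sub_self]; exact Ideal.zero_mem _)
    have hx'2' : x' 2 = algebraMap R' (AdicCompletion (maximalIdeal R') R') (φ p₂) := by
      rw [hx'2, hx2, adicCompletionMap_algebraMap]
    obtain ⟨-, hβeq⟩ := completedChain_curveStep_laws φ hφm hdim hdim' p₁ hI₁ x hx1 hgenx hne hδ hperm x' hx'1 hgen'x h₀ hx'2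
    refine ⟨x', φ p₁, φ p₂, false, hx'1, hx'2', hgen'x, hprep', hne', hδ', by simpa using huN'.symm,
      hpres_of p₁ p₂ y'' y' hf hP'' hgen'' had'' hy' hgen', ?_, fun _ => ⟨hsurj, ?_⟩⟩
    · simp only [Bool.false_eq_true, if_false, add_zero]; omega
    · rw [huN', ← map_span_singleton', hf, map_span_singleton']
  · ---------------------------------------------------------------- flag 2: the `(0,2)` curve `(ŷ, p₂)`, via the swap
    have hf : Ideal.span {p₂} = Ideal.span {uN} := by simpa using hflag
    have hgen₂ : Ideal.span {l, p₂, p₁} = maximalIdeal R := by rw [span_triple_swap23']; exact hgenR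
    have had₂ : ∀ G ∈ initialForms ![l, p₂, p₁] I μ, ∃ a : ResidueField R, G = C a * X 0 ^ μ :=
      forall_initialForms_of_eq_zero (![l, p₁, p₂]) hdim hIμ (![l, p₂, p₁]) hgenR hgen₂ rfl hadR
    obtain ⟨y'', hgen'', hP'', had''⟩ := hpresent p₂ p₁ hf hgen₂ had₂
    obtain ⟨hsurj, y', hy', hgen'⟩ := hcurve y'' p₂ p₁ hf hP'' hgen'' had''
    have huN' : Ideal.span {uN'} = Ideal.span {φ p₂} := by
      rw [← hexc_cv, ← hP'', map_span_pair_eq_span_of_mul φ hy']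
    have hI₂ : I' = (I.map φ).colon {φ p₂ ^ μ} := hI.trans (colon_singleton_pow_eq_of_span_singleton_eq _ huN' μ)
    -- the swapped formal label `(ŷ, ι p₂, ι p₁)`
    set xs : Fin 3 → AdicCompletion (maximalIdeal R) R := x ∘ σ₁₂ with hxsdef
    have hxs0 : xs 0 = x 0 := by simp [hxsdef]
    have hxs1 : xs 1 = algebraMap R (AdicCompletion (maximalIdeal R) R) p₂ := by simp [hxsdef, hx2]
    have hxs2 : xs 2 = algebraMap R (AdicCompletion (maximalIdeal R) R) p₁ := by simp [hxsdef, hx1]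
    have hgens : Ideal.span {xs 0, xs 1, xs 2} = maximalIdeal (AdicCompletion (maximalIdeal R) R) := by
      rw [hxsdef, span_triple_comp_σ₁₂]; exact hgenx
    have hpreps : ∀ B, PreparedUpTo xs (I.map (algebraMap R (AdicCompletion (maximalIdeal R) R))) μ B :=
      preparedUpTo_forall_comp_σ₁₂ x hgenx hdimA hprep
    have hnes : (pts xs (I.map (algebraMap R (AdicCompletion (maximalIdeal R) R))) μ).Nonempty :=
      (pts_comp_σ₁₂_nonempty_iff x _ μ).mpr hne
    have hδs : μ.factorial < deltaS xs (I.map (algebraMap R (AdicCompletion (maximalIdeal R) R))) μ := by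
      rw [hxsdef, deltaS_comp_σ₁₂]; exact hδ
    obtain ⟨xs', hxs'1, hgen's, h₀, hxs'2, hperm, hprep's, hne's, hδ's, -, -⟩ :=
      completedChain_curve_step φ hφm hdim hdim' hsurj p₂ hIμ hIne hIμ' hIne' hI₂ hτ' P hIP (hcurve₁ p₂ hf) xs hxs1 hgens
        hpreps hnes hδs y'' p₁ hP'' hgen'' had'' (by rw [hxs2, sub_self]; exact Ideal.zero_mem _)
    -- swap back: `x′ = (ŷ′, ι′ φ p₁, ι′ φ p₂)`
    set x' : Fin 3 → AdicCompletion (maximalIdeal R') R' := xs' ∘ σ₁₂ with hx'def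
    have hx'0 : x' 0 = xs' 0 := by simp [hx'def]
    have hx'1 : x' 1 = algebraMap R' (AdicCompletion (maximalIdeal R') R') (φ p₁) := by
      have : x' 1 = xs' 2 := by simp [hx'def]
      rw [this, hxs'2, hxs2, adicCompletionMap_algebraMap]
    have hx'2 : x' 2 = algebraMap R' (AdicCompletion (maximalIdeal R') R') (φ p₂) := by
      have : x' 2 = xs' 1 := by simp [hx'def]
      rw [this, hxs'1]
    have hgen'x : Ideal.span {x' 0, x' 1, x' 2} = maximalIdeal (AdicCompletion (maximalIdeal R') R') := by
      rw [hx'def, span_triple_comp_σ₁₂]; exact hgen's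
    have hprep' : ∀ B, PreparedUpTo x' (I'.map (algebraMap R' (AdicCompletion (maximalIdeal R') R'))) μ B :=
      preparedUpTo_forall_comp_σ₁₂ xs' hgen's hdimB hprep's
    have hne' : (pts x' (I'.map (algebraMap R' (AdicCompletion (maximalIdeal R') R'))) μ).Nonempty :=
      (pts_comp_σ₁₂_nonempty_iff xs' _ μ).mpr hne's
    have hδ' : μ.factorial < deltaS x' (I'.map (algebraMap R' (AdicCompletion (maximalIdeal R') R'))) μ := by
      rw [hx'def, deltaS_comp_σ₁₂]; exact hδ's
    -- the laws in print orientation: `β′ + L ≤ β`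
    have hJ' := weakTransform_adicCompletion_of_eq φ hφm hI₂
    have hperm' : I.map (algebraMap R (AdicCompletion (maximalIdeal R) R)) ≤ Ideal.span {x 0, x 2} ^ μ := by
      rw [← hxs0, hx2, ← hxs1]; exact hperm
    have hc1 : x' 1 = adicCompletionMap (maximalIdeal R) (maximalIdeal R') φ hφm (x 1) := by
      rw [hx'1, hx1, adicCompletionMap_algebraMap]
    have hc2 : x' 2 = adicCompletionMap (maximalIdeal R) (maximalIdeal R') φ hφm (x 2) := by
      rw [hx'2, hx2, adicCompletionMap_algebraMap]
    have hc0 : adicCompletionMap (maximalIdeal R) (maximalIdeal R') φ hφm (x 0) =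
        adicCompletionMap (maximalIdeal R) (maximalIdeal R') φ hφm (x 2) * x' 0 := by
      rw [← hxs0, hx2, ← hxs1, hx'0]; exact h₀
    obtain ⟨-, hβ⟩ := completedChain_curveStepTwo_laws φ hφm hdim hdim' x hgenx hperm' hne hδ x' hgen'x hc1 hc0 hc2
    rw [hx2, ← hJ'] at hβ
    refine ⟨x', φ p₁, φ p₂, true, hx'1, hx'2, hgen'x, hprep', hne', hδ', by simpa using huN'.symm,
      hpres_of p₂ p₁ y'' y' hf hP'' hgen'' had'' hy' hgen', ?_, fun heq => ?_⟩
    · simp only [if_true]; omega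
    · exfalso; simp only [if_true] at heq; omega

end CurveStep

end Literature.AlgebraicGeometry.Resolution

end
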